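import Mathlib
import HarnessLib

/-!
# The van der Waerden permanent bound (Egorychev–Falikman) — named fact

Van der Waerden conjectured (1926) and Egorychev [Egorychev1981] and Falikman [Falikman1981]
proved: the permanent of every doubly stochastic real `m × m` matrix is at least `m! / m^m`, with
equality only for the matrix all of whose entries are `1/m`.  We record the inequality as a NAMED
FACT `VanDerWaerdenPermanent : Prop` — PROVED: `VanDerWaerdenPermanent_holds` in the sibling file
`VanDerWaerdenPermanentProofs.lean` (which imports this one; Gurvits' capacity argument) — in the
division-free form
`m! ≤ m^m · per A` that the consumers in the tree already take as an explicit hypothesis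
(`Summit.…Theorems.DivisionGap.PerMultiplesHard.DensePerHardReg.densePerHardReg`,
`….pow_mul_factorial_le_of_vdW`): for a `k`-regular bipartite graph `G ⊆ [n]²` it gives
`k^n · n! ≤ n^n · #PM(G)`.

Statement as printed: Egorychev 1981, Theorem 1 (p. 300), "`min_{X ∈ Ω_n} per X = n!/nⁿ`, and
`per X = n!/nⁿ` if and only if `X = J_n`" (`Ω_n` = the doubly stochastic `n × n` matrices, `J_n` =
the matrix all of whose entries are `1/n`); Falikman 1981, Theorem 1: if `A` is a doubly stochastic
`n × n` matrix then `per A ≥ n!/nⁿ`.  Doubly stochastic is spelled out entrywise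
(nonnegative entries, all row sums and all column sums equal to `1`), which is
`mem_doublyStochastic_iff_sum` for Mathlib's `doublyStochastic` submonoid; the permanent is
Mathlib's `Matrix.permanent` (`per A = Σ_σ Π_i A (σ i) i`).  For `m = 0` the statement reads
`1 ≤ 1 · 1` (true), so no side condition is needed.

Not in this file: the equality case (`per X = n!/nⁿ ↔ X = J_n`, the second half of Egorychev's
Theorem 1) and the generalisations (Schrijver's bound for regular bipartite graphs).  The proof of
the inequality lives in `VanDerWaerdenPermanentProofs.lean` (Gurvits 2008, real stable polynomials
and capacity), not Egorychev's mixed-discriminant argument.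
-/

namespace Literature.Combinatorics.Enumerative

/-- **The van der Waerden permanent bound (Egorychev–Falikman theorem), named fact.**  For every
`m` and every real `m × m` matrix `A` with nonnegative entries whose rows and columns all sum to `1`
(doubly stochastic), `m! ≤ m^m · per A`, i.e. `per A ≥ m!/m^m`.  Proved:
`VanDerWaerdenPermanent_holds` (sibling file `VanDerWaerdenPermanentProofs.lean`); consumers that
take `(h : VanDerWaerdenPermanent)` as a hypothesis are fed that theorem.
[cite: Egorychev1981, Theorem 1 (p. 300)] -/
def VanDerWaerdenPermanent : Prop :=
  ∀ (m : ℕ) (A : Matrix (Fin m) (Fin m) ℝ), (∀ i j, 0 ≤ A i j) →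
    (∀ i, ∑ j, A i j = 1) → (∀ j, ∑ i, A i j = 1) →
    (m.factorial : ℝ) ≤ (m : ℝ) ^ m * A.permanent

/-- The named fact quantifies exactly over Mathlib's doubly stochastic matrices: the entrywise
hypotheses are `mem_doublyStochastic_iff_sum`. [folklore] -/
theorem vanDerWaerdenPermanent_iff_doublyStochastic :
    VanDerWaerdenPermanent ↔
      ∀ (m : ℕ) (A : Matrix (Fin m) (Fin m) ℝ), A ∈ doublyStochastic ℝ (Fin m) →
        (m.factorial : ℝ) ≤ (m : ℝ) ^ m * A.permanent := by
  constructor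
  · intro h m A hA
    rw [mem_doublyStochastic_iff_sum] at hA
    exact h m A hA.1 hA.2.1 hA.2.2
  · intro h m A h0 hr hc
    exact h m A (mem_doublyStochastic_iff_sum.mpr ⟨h0, hr, hc⟩)

end Literature.Combinatorics.Enumerative
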